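import Literature.Probability.LatticeModels.DobrushinTiltOscillation
import HarnessLib

/-!
# Simon's lemma: the linear (and the sharp) total-variation bound for Gibbs tilts

[topic Probability/LatticeModels]

Simon's device for Dobrushin's uniqueness theorem (B. Simon, *A remark on Dobrushin's uniqueness
theorem*, Commun. Math. Phys. **68** (1979) 183–185; Lemma, p. 184): for a probability measure
`μ₀` on the single-spin space and `h, g ∈ C(Ω)`, the tilts `dμ_h = e^h dμ₀ / ∫ e^h dμ₀` satisfy
`‖μ_h − μ_g‖ ≤ ‖h − g‖_∞` in the total-variation NORM `‖ν‖ = sup {|ν(f)| : ‖f‖_∞ = 1}`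
(proof: interpolate `ν_θ = μ_{θ h + (1−θ) g}`, `d/dθ ν_θ(f) = ν_θ(f q) − ν_θ(f) ν_θ(q)`,
`q = h − g`, and Schwarz); Remark 2, p. 185: since `ν_θ((q − ν_θ q)²) ≤ ν_θ((q − a)²)` one may
replace `‖h − g‖_∞` by `‖h − g − a‖_∞` for any constant `a`. In the normalisation of the tree's
`DobrushinMetric.abs_integral_tilted_sub_integral_tilted_le` (the EXPONENTIAL form
`½ (e^{2ε} − 1) · L`, Georgii 2011, Prop. 8.8): if `|h₁ − h₂ − κ| ≤ ε` pointwise and the bounded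
observable `φ` has oscillation `≤ L`, then `|∫ φ dμ^{h₁} − ∫ φ dμ^{h₂}| ≤ ½ ‖μ^{h₁} − μ^{h₂}‖ · L`
and Simon's lemma reads

  `|∫ φ dμ^{h₁} − ∫ φ dμ^{h₂}| ≤ (ε / 2) · L`          (`abs_integral_tilted_sub_integral_tilted_le_linear`).

This is the estimate behind the LINEAR high-temperature criteria (Simon 1979, Theorem:
`∑_{X ∋ 0} (|X| − 1) ‖Φ(X)‖_∞ < 1`; Georgii 2011, Prop. 8.8; Friedli–Velenik 2017, Thm. 6.35 /
Cor. 6.37), a factor `(e^{2ε} − 1)/ε ≥ 2` better than the exponential form. We prove it through the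
SHARP form

  `|∫ φ dμ^{h₁} − ∫ φ dμ^{h₂}| ≤ tanh(ε/2) · L = ((e^ε − 1)/(e^ε + 1)) · L`
                                                     (`abs_integral_tilted_sub_integral_tilted_le_sharp`),

whose constant is attained by two-point laws (`μ₀ = (1−p) δ_a + p δ_b`, `h₂ = 0`,
`h₁(a) = −ε`, `h₁(b) = ε`, `p = 1/(1 + e^{ε})`, `φ = 1_{b}`), by a derivative-free argument
replacing Simon's interpolation: with `pᵢ = e^{hᵢ}/Zᵢ` the two densities, `r p₂ ≤ p₁ ≤ r e^{2ε} p₂` pointwise for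
`r = e^{κ−ε} Z₂/Z₁ ≤ 1 ≤ r e^{2ε}`; the convex function `(p₂ − p₁)⁺` of `p₁ ∈ [r p₂, r e^{2ε} p₂]`
lies below its chord, whence `(r e^{2ε} − r) ∫ |p₁ − p₂| ≤ 2 (1 − r)(r e^{2ε} − 1)`, and
`(1 − r)(r e^{2ε} − 1) ≤ r (e^ε − 1)²`. Finally `tanh(ε/2) ≤ ε/2` is `2 (e^ε − 1) ≤ ε (e^ε + 1)`
(the logarithmic mean lies below the arithmetic mean).

## Main statements

* `DobrushinMetric.abs_integral_tilted_sub_integral_tilted_le_sharp` — the `tanh(ε/2)` form.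
* `DobrushinMetric.abs_integral_tilted_sub_integral_tilted_le_linear` — Simon's `ε/2` form.
* `DobrushinMetric.abs_integral_tilted_sub_integral_tilted_le_tanh` — the same with `Real.tanh`.
* `DobrushinMetric.abs_integral_tilted_sub_integral_tilted_le_linear'` — sup-norm form (`κ = 0`).

## References
* B. Simon, *A remark on Dobrushin's uniqueness theorem*, Commun. Math. Phys. 68 (1979) 183–185,
  Lemma (p. 184) and Remarks 1–2 (p. 185).
* H.-O. Georgii, *Gibbs Measures and Phase Transitions*, 2nd ed. (2011), Prop. 8.8.
* S. Friedli, Y. Velenik, *Statistical Mechanics of Lattice Systems*, CUP (2017), Thm. 6.35 and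
  its proof (interpolation + Cauchy–Schwarz), Cor. 6.37.
-/

noncomputable section

open MeasureTheory Real

namespace Literature.Probability.LatticeModels.DobrushinMetric

variable {S : Type*} [MeasurableSpace S]

/-! ### Two real inequalities -/

/-- `2 (e^u − 1) ≤ u (e^u + 1)` for `u ≥ 0`: the logarithmic mean of `1, e^u` is below their
arithmetic mean; equivalently `tanh (u/2) ≤ u/2`. [folklore] -/
private lemma two_mul_exp_sub_one_le {u : ℝ} (hu : 0 ≤ u) :
    2 * (exp u - 1) ≤ u * (exp u + 1) := by
  have hmono : MonotoneOn (fun t : ℝ => t * (exp t + 1) - 2 * (exp t - 1)) (Set.Ici 0) := by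
    refine monotoneOn_of_deriv_nonneg (convex_Ici 0) ?_ ?_ fun t ht => ?_
    · exact (Continuous.continuousOn (by fun_prop))
    · exact (Differentiable.differentiableOn (by fun_prop))
    · have hd : HasDerivAt (fun t : ℝ => t * (exp t + 1) - 2 * (exp t - 1))
          (1 * (exp t + 1) + t * exp t - 2 * exp t) t := by
        have h1 : HasDerivAt (fun t : ℝ => t * (exp t + 1)) (1 * (exp t + 1) + t * exp t) t :=
          (hasDerivAt_id' t).mul ((Real.hasDerivAt_exp t).add_const 1)
        have h2 : HasDerivAt (fun t : ℝ => 2 * (exp t - 1)) (2 * exp t) t := by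
          simpa using ((Real.hasDerivAt_exp t).sub_const 1).const_mul 2
        exact h1.sub h2
      rw [hd.deriv]
      have h3 : (1 - t) * exp t ≤ 1 := by
        calc (1 - t) * exp t ≤ exp (-t) * exp t :=
              mul_le_mul_of_nonneg_right (by linarith [Real.add_one_le_exp (-t)]) (exp_pos t).le
          _ = 1 := by rw [← exp_add, neg_add_cancel, exp_zero]
      nlinarith [exp_pos t]
  have h := hmono (Set.mem_Ici.2 (le_refl (0 : ℝ))) (Set.mem_Ici.2 hu) hu
  simp only [zero_mul, exp_zero, sub_self, mul_zero] at h
  linarith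

/-- `(e^ε − 1)/(e^ε + 1) ≤ ε/2` for `ε ≥ 0`. [folklore] -/
private lemma exp_sub_one_div_exp_add_one_le {ε : ℝ} (hε : 0 ≤ ε) :
    (exp ε - 1) / (exp ε + 1) ≤ ε / 2 := by
  rw [div_le_div_iff₀ (by positivity) two_pos]
  have := two_mul_exp_sub_one_le hε
  linarith

/-- Bookkeeping: `tanh(ε/2) = (e^ε − 1)/(e^ε + 1)`. [folklore] -/
private lemma tanh_half_eq (ε : ℝ) : Real.tanh (ε / 2) = (exp ε - 1) / (exp ε + 1) := by
  rw [Real.tanh_eq_sinh_div_cosh, Real.sinh_eq, Real.cosh_eq]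
  have hε : exp ε = exp (ε / 2) * exp (ε / 2) := by rw [← exp_add]; ring_nf
  have hne : exp (-(ε / 2)) = (exp (ε / 2))⁻¹ := exp_neg _
  rw [hne, hε]
  have hp : 0 < exp (ε / 2) := exp_pos _
  field_simp

/-! ### The chord bound for two comparable probability densities -/

/-- **Chord bound.** If `p₁, p₂` are probability densities w.r.t. `μ` with `rlo p₂ ≤ p₁ ≤ rhi p₂`
pointwise, `rlo ≤ 1 ≤ rhi`, and `|φ − m| ≤ L/2`, then
`(rhi − rlo) |∫ p₁ φ − ∫ p₂ φ| ≤ (1 − rlo)(rhi − 1) L`: the convex function `(p₂ − p₁)⁺` of `p₁` on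
`[rlo p₂, rhi p₂]` lies below its chord. [folklore] -/
private lemma abs_integral_mul_sub_integral_mul_le_chord (μ : Measure S) {p₁ p₂ φ : S → ℝ}
    (hp₁ : Integrable p₁ μ) (hp₂ : Integrable p₂ μ)
    (hp₁φ : Integrable (fun s => p₁ s * φ s) μ) (hp₂φ : Integrable (fun s => p₂ s * φ s) μ)
    (hp₁1 : ∫ s, p₁ s ∂μ = 1) (hp₂1 : ∫ s, p₂ s ∂μ = 1)
    {rlo rhi : ℝ} (hrlo : rlo ≤ 1) (hrhi : 1 ≤ rhi)
    (hlo : ∀ s, rlo * p₂ s ≤ p₁ s) (hhi : ∀ s, p₁ s ≤ rhi * p₂ s)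
    {m L : ℝ} (hL : 0 ≤ L) (hm : ∀ s, |φ s - m| ≤ L / 2) :
    (rhi - rlo) * |∫ s, p₁ s * φ s ∂μ - ∫ s, p₂ s * φ s ∂μ| ≤ (1 - rlo) * (rhi - 1) * L := by
  have hrr : 0 ≤ rhi - rlo := by linarith
  -- `∫ p₁ φ − ∫ p₂ φ = ∫ (p₁ − p₂)(φ − m)`
  have hfun : (fun s => (p₁ s - p₂ s) * (φ s - m))
      = fun s => (p₁ s * φ s - p₂ s * φ s) - m * (p₁ s - p₂ s) := by
    funext s; ring
  have hint : Integrable (fun s => (p₁ s - p₂ s) * (φ s - m)) μ := by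
    rw [hfun]
    exact (hp₁φ.sub' hp₂φ).sub' ((hp₁.sub' hp₂).const_mul m)
  have key : ∫ s, p₁ s * φ s ∂μ - ∫ s, p₂ s * φ s ∂μ = ∫ s, (p₁ s - p₂ s) * (φ s - m) ∂μ := by
    rw [hfun, integral_sub (hp₁φ.sub' hp₂φ) ((hp₁.sub' hp₂).const_mul m), integral_sub hp₁φ hp₂φ,
      integral_const_mul, integral_sub hp₁ hp₂, hp₁1, hp₂1]
    ring
  -- the pointwise chord inequality
  have chord : ∀ s, (rhi - rlo) * |p₁ s - p₂ s| ≤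
      (rhi - rlo) * (p₁ s - p₂ s) + 2 * ((1 - rlo) * (rhi * p₂ s - p₁ s)) := by
    intro s
    rcases le_total (p₂ s) (p₁ s) with h | h
    · rw [abs_of_nonneg (sub_nonneg.2 h)]
      have : 0 ≤ (1 - rlo) * (rhi * p₂ s - p₁ s) :=
        mul_nonneg (sub_nonneg.2 hrlo) (sub_nonneg.2 (hhi s))
      linarith
    · rw [abs_of_nonpos (sub_nonpos.2 h)]
      have : 0 ≤ (rhi - 1) * (p₁ s - rlo * p₂ s) :=
        mul_nonneg (sub_nonneg.2 hrhi) (sub_nonneg.2 (hlo s))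
      nlinarith
  have hGint : Integrable
      (fun s => (rhi - rlo) * (p₁ s - p₂ s) + 2 * ((1 - rlo) * (rhi * p₂ s - p₁ s))) μ :=
    Integrable.add ((hp₁.sub hp₂).const_mul _)
      ((((hp₂.const_mul rhi).sub hp₁).const_mul _).const_mul _)
  have hG : ∫ s, ((rhi - rlo) * (p₁ s - p₂ s) + 2 * ((1 - rlo) * (rhi * p₂ s - p₁ s))) ∂μ =
      2 * ((1 - rlo) * (rhi - 1)) := by
    rw [integral_add ((hp₁.sub' hp₂).const_mul _)
        ((((hp₂.const_mul rhi).sub' hp₁).const_mul _).const_mul _),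
      integral_const_mul, integral_sub hp₁ hp₂, integral_const_mul, integral_const_mul,
      integral_sub (hp₂.const_mul rhi) hp₁, integral_const_mul, hp₁1, hp₂1]
    ring
  -- assemble
  have habs : Integrable (fun s => |p₁ s - p₂ s|) μ := (hp₁.sub' hp₂).abs
  calc (rhi - rlo) * |∫ s, p₁ s * φ s ∂μ - ∫ s, p₂ s * φ s ∂μ|
      = (rhi - rlo) * |∫ s, (p₁ s - p₂ s) * (φ s - m) ∂μ| := by rw [key]
    _ ≤ (rhi - rlo) * ∫ s, |p₁ s - p₂ s| * (L / 2) ∂μ := by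
        refine mul_le_mul_of_nonneg_left ?_ hrr
        refine (abs_integral_le_integral_abs).trans ?_
        refine integral_mono hint.abs (habs.mul_const _) fun s => ?_
        show |(p₁ s - p₂ s) * (φ s - m)| ≤ |p₁ s - p₂ s| * (L / 2)
        rw [abs_mul]
        exact mul_le_mul_of_nonneg_left (hm s) (abs_nonneg _)
    _ = (L / 2) * ∫ s, (rhi - rlo) * |p₁ s - p₂ s| ∂μ := by
        rw [integral_mul_const, integral_const_mul]; ring
    _ ≤ (L / 2) * ∫ s, ((rhi - rlo) * (p₁ s - p₂ s) + 2 * ((1 - rlo) * (rhi * p₂ s - p₁ s))) ∂μ := by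
        refine mul_le_mul_of_nonneg_left ?_ (by linarith)
        exact integral_mono (habs.const_mul _) hGint chord
    _ = (1 - rlo) * (rhi - 1) * L := by rw [hG]; ring

/-! ### Simon's lemma, sharp and linear forms -/

/-- **Sharp total-variation bound for tilts** (sharpening the constant in Simon 1979, Lemma p. 184
with Remark 2 p. 185, and in Georgii 2011, Prop. 8.8): for a probability measure `μ`, bounded
measurable `h₁, h₂ : S → ℝ` with `|h₁ − h₂ − κ| ≤ ε` pointwise for some constant `κ`, and a
bounded measurable `φ` with oscillation `≤ L` (`|φ a − φ b| ≤ L`), the tilted measures satisfy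
`|∫ φ dμ^{h₁} − ∫ φ dμ^{h₂}| ≤ ((e^ε − 1)/(e^ε + 1)) · L = tanh(ε/2) · L`. The constant is
attained by two-point laws. The printed (linear) form `(ε/2) · L` is
`abs_integral_tilted_sub_integral_tilted_le_linear`. [cite: Simon1979Dobrushin, Lemma and Remark 2] -/
theorem abs_integral_tilted_sub_integral_tilted_le_sharp (μ : Measure S) [IsProbabilityMeasure μ]
    {h₁ h₂ : S → ℝ} (h1m : Measurable h₁) (h2m : Measurable h₂)
    (h1b : ∃ B, ∀ s, |h₁ s| ≤ B) (h2b : ∃ B, ∀ s, |h₂ s| ≤ B)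
    {κ ε : ℝ} (hε : ∀ s, |h₁ s - h₂ s - κ| ≤ ε)
    {φ : S → ℝ} (hφm : Measurable φ) (hφb : ∃ M, ∀ s, |φ s| ≤ M)
    {L : ℝ} (hφL : ∀ a b, |φ a - φ b| ≤ L) :
    |∫ s, φ s ∂(μ.tilted h₁) - ∫ s, φ s ∂(μ.tilted h₂)| ≤ (exp ε - 1) / (exp ε + 1) * L := by
  obtain ⟨s₀, -⟩ : (Set.univ : Set S).Nonempty :=
    nonempty_of_measure_ne_zero (μ := μ) (by rw [measure_univ]; exact one_ne_zero)
  have hL : 0 ≤ L := by simpa using hφL s₀ s₀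
  have hε0 : 0 ≤ ε := (abs_nonneg _).trans (hε s₀)
  have I₁ := integrable_exp_of_abs_le μ h1m h1b
  have I₂ := integrable_exp_of_abs_le μ h2m h2b
  set Z₁ : ℝ := ∫ s, exp (h₁ s) ∂μ with hZ₁def
  set Z₂ : ℝ := ∫ s, exp (h₂ s) ∂μ with hZ₂def
  have hZ₁ : 0 < Z₁ := integral_exp_pos I₁
  have hZ₂ : 0 < Z₂ := integral_exp_pos I₂
  have hup : ∀ s, exp (h₁ s) ≤ exp (κ + ε) * exp (h₂ s) := fun s => by
    rw [← exp_add, exp_le_exp]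
    have := (abs_le.mp (hε s)).2
    linarith
  have hlow : ∀ s, exp (κ - ε) * exp (h₂ s) ≤ exp (h₁ s) := fun s => by
    rw [← exp_add, exp_le_exp]
    have := (abs_le.mp (hε s)).1
    linarith
  have hZu : Z₁ ≤ exp (κ + ε) * Z₂ := by
    rw [hZ₂def, ← integral_const_mul]
    exact integral_mono I₁ (I₂.const_mul _) hup
  have hZl : exp (κ - ε) * Z₂ ≤ Z₁ := by
    rw [hZ₂def, ← integral_const_mul]
    exact integral_mono (I₂.const_mul _) I₁ hlow
  obtain ⟨M, hM⟩ := hφb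
  obtain ⟨m, hm⟩ := exists_forall_abs_sub_le_half ⟨M, hM⟩ hφL
  have hφbd : ∀ᵐ s ∂μ, ‖φ s‖ ≤ M := ae_of_all _ fun s => by rw [Real.norm_eq_abs]; exact hM s
  -- the two densities and the ratio window `[rlo, rhi]`
  set rlo : ℝ := exp (κ - ε) * Z₂ / Z₁ with hrlodef
  set rhi : ℝ := exp (κ + ε) * Z₂ / Z₁ with hrhidef
  have hrlo1 : rlo ≤ 1 := by rw [hrlodef, div_le_one hZ₁]; exact hZl
  have hrhi1 : 1 ≤ rhi := by rw [hrhidef, one_le_div hZ₁]; exact hZu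
  have hrlo0 : 0 < rlo := by rw [hrlodef]; positivity
  have hlo : ∀ s, rlo * (exp (h₂ s) / Z₂) ≤ exp (h₁ s) / Z₁ := fun s => by
    rw [hrlodef]
    calc exp (κ - ε) * Z₂ / Z₁ * (exp (h₂ s) / Z₂) = exp (κ - ε) * exp (h₂ s) / Z₁ := by
          field_simp
      _ ≤ exp (h₁ s) / Z₁ := div_le_div_of_nonneg_right (hlow s) hZ₁.le
  have hhi : ∀ s, exp (h₁ s) / Z₁ ≤ rhi * (exp (h₂ s) / Z₂) := fun s => by
    rw [hrhidef]
    calc exp (h₁ s) / Z₁ ≤ exp (κ + ε) * exp (h₂ s) / Z₁ :=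
          div_le_div_of_nonneg_right (hup s) hZ₁.le
      _ = exp (κ + ε) * Z₂ / Z₁ * (exp (h₂ s) / Z₂) := by field_simp
  have hP₁ : Integrable (fun s => exp (h₁ s) / Z₁) μ := I₁.div_const _
  have hP₂ : Integrable (fun s => exp (h₂ s) / Z₂) μ := I₂.div_const _
  have hP₁1 : ∫ s, exp (h₁ s) / Z₁ ∂μ = 1 := by rw [integral_div, hZ₁def, div_self hZ₁.ne']
  have hP₂1 : ∫ s, exp (h₂ s) / Z₂ ∂μ = 1 := by rw [integral_div, hZ₂def, div_self hZ₂.ne']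
  have main := abs_integral_mul_sub_integral_mul_le_chord μ hP₁ hP₂
    (hP₁.mul_bdd hφm.aestronglyMeasurable hφbd) (hP₂.mul_bdd hφm.aestronglyMeasurable hφbd)
    hP₁1 hP₂1 hrlo1 hrhi1 hlo hhi hL hm
  rw [integral_tilted, integral_tilted]
  simp only [smul_eq_mul]
  set Δ : ℝ := |∫ s, exp (h₁ s) / Z₁ * φ s ∂μ - ∫ s, exp (h₂ s) / Z₂ * φ s ∂μ| with hΔdef
  have hΔ0 : 0 ≤ Δ := abs_nonneg _
  rcases hε0.eq_or_lt with hε00 | hεpos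
  · -- degenerate case `ε = 0`: the two densities coincide
    subst hε00
    have hrr : rlo = rhi := by rw [hrlodef, hrhidef, sub_zero, add_zero]
    have hpeq : ∀ s, exp (h₁ s) / Z₁ = rlo * (exp (h₂ s) / Z₂) := fun s =>
      le_antisymm (by rw [hrr]; exact hhi s) (hlo s)
    have hr1 : rlo = 1 := by
      have h := hP₁1
      simp_rw [hpeq] at h
      rw [integral_const_mul, hP₂1, mul_one] at h
      exact h
    have hzero : Δ = 0 := by
      rw [hΔdef, abs_eq_zero, sub_eq_zero]
      refine integral_congr_ae (ae_of_all _ fun s => ?_)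
      show exp (h₁ s) / Z₁ * φ s = exp (h₂ s) / Z₂ * φ s
      rw [hpeq s, hr1, one_mul]
    rw [hzero, exp_zero]
    simp
  · -- `ε > 0`: `rhi = a² rlo` with `a = e^ε > 1`
    set a : ℝ := exp ε with hadef
    have ha1 : 1 < a := by rw [hadef]; exact Real.one_lt_exp_iff.2 hεpos
    have hra : rhi = a * a * rlo := by
      rw [hrhidef, hrlodef, hadef]
      have : exp (κ + ε) = exp ε * exp ε * exp (κ - ε) := by
        rw [← exp_add, ← exp_add]; ring_nf
      rw [this]; ring
    rw [hra] at main
    -- `(1 − ρ)(a²ρ − 1) ≤ ρ (a − 1)²`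
    have hamgm : (1 - rlo) * (a * a * rlo - 1) ≤ rlo * (a - 1) ^ 2 := by
      nlinarith [sq_nonneg (a * rlo - 1)]
    have h1 : rlo * ((a * a - 1) * Δ) ≤ rlo * ((a - 1) ^ 2 * L) := by
      have := main.trans (mul_le_mul_of_nonneg_right hamgm hL)
      nlinarith
    have h2 : (a * a - 1) * Δ ≤ (a - 1) ^ 2 * L := le_of_mul_le_mul_left h1 hrlo0
    have h3 : (a + 1) * Δ ≤ (a - 1) * L := by
      have h4 : (a - 1) * ((a + 1) * Δ) ≤ (a - 1) * ((a - 1) * L) := by nlinarith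
      exact le_of_mul_le_mul_left h4 (by linarith)
    rw [div_mul_eq_mul_div, le_div_iff₀ (by linarith), mul_comm]
    linarith

/-- **Sharp total-variation bound for tilts, `tanh` form**: under the hypotheses of
`abs_integral_tilted_sub_integral_tilted_le_sharp`,
`|∫ φ dμ^{h₁} − ∫ φ dμ^{h₂}| ≤ tanh(ε/2) · L` (sharpening the constant `ε/2` of Simon 1979, Lemma
p. 184 with Remark 2 p. 185). [cite: Simon1979Dobrushin, Lemma and Remark 2] -/
theorem abs_integral_tilted_sub_integral_tilted_le_tanh (μ : Measure S) [IsProbabilityMeasure μ]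
    {h₁ h₂ : S → ℝ} (h1m : Measurable h₁) (h2m : Measurable h₂)
    (h1b : ∃ B, ∀ s, |h₁ s| ≤ B) (h2b : ∃ B, ∀ s, |h₂ s| ≤ B)
    {κ ε : ℝ} (hε : ∀ s, |h₁ s - h₂ s - κ| ≤ ε)
    {φ : S → ℝ} (hφm : Measurable φ) (hφb : ∃ M, ∀ s, |φ s| ≤ M)
    {L : ℝ} (hφL : ∀ a b, |φ a - φ b| ≤ L) :
    |∫ s, φ s ∂(μ.tilted h₁) - ∫ s, φ s ∂(μ.tilted h₂)| ≤ Real.tanh (ε / 2) * L := by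
  rw [tanh_half_eq]
  exact abs_integral_tilted_sub_integral_tilted_le_sharp μ h1m h2m h1b h2b hε hφm hφb hφL

/-- **Simon's lemma** (Simon 1979, Lemma p. 184 with Remark 2 p. 185: `‖μ_h − μ_g‖ ≤ ‖h − g − a‖_∞`
in the total-variation norm; equivalently Georgii 2011, Prop. 8.8 / Friedli–Velenik 2017, proof of
Thm. 6.35): for a probability measure `μ`, bounded measurable `h₁, h₂ : S → ℝ` with
`|h₁ − h₂ − κ| ≤ ε` pointwise for some constant `κ`, and a bounded measurable `φ` with oscillation
`≤ L`, `|∫ φ dμ^{h₁} − ∫ φ dμ^{h₂}| ≤ (ε/2) · L`. (The tree's exponential form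
`abs_integral_tilted_sub_integral_tilted_le` has `½ (e^{2ε} − 1) ≥ ε` in place of `ε/2`.)
[cite: Simon1979Dobrushin, Lemma and Remark 2] -/
theorem abs_integral_tilted_sub_integral_tilted_le_linear (μ : Measure S) [IsProbabilityMeasure μ]
    {h₁ h₂ : S → ℝ} (h1m : Measurable h₁) (h2m : Measurable h₂)
    (h1b : ∃ B, ∀ s, |h₁ s| ≤ B) (h2b : ∃ B, ∀ s, |h₂ s| ≤ B)
    {κ ε : ℝ} (hε : ∀ s, |h₁ s - h₂ s - κ| ≤ ε)
    {φ : S → ℝ} (hφm : Measurable φ) (hφb : ∃ M, ∀ s, |φ s| ≤ M)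
    {L : ℝ} (hφL : ∀ a b, |φ a - φ b| ≤ L) :
    |∫ s, φ s ∂(μ.tilted h₁) - ∫ s, φ s ∂(μ.tilted h₂)| ≤ ε / 2 * L := by
  obtain ⟨s₀, -⟩ : (Set.univ : Set S).Nonempty :=
    nonempty_of_measure_ne_zero (μ := μ) (by rw [measure_univ]; exact one_ne_zero)
  have hL : 0 ≤ L := by simpa using hφL s₀ s₀
  have hε0 : 0 ≤ ε := (abs_nonneg _).trans (hε s₀)
  exact (abs_integral_tilted_sub_integral_tilted_le_sharp μ h1m h2m h1b h2b hε hφm hφb hφL).trans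
    (mul_le_mul_of_nonneg_right (exp_sub_one_div_exp_add_one_le hε0) hL)

/-- **Simon's lemma, sup-norm form** (Simon 1979, Lemma p. 184, `‖μ_h − μ_g‖ ≤ ‖h − g‖_∞`): with
`|h₁ − h₂| ≤ ε` pointwise (no centring constant), `|∫ φ dμ^{h₁} − ∫ φ dμ^{h₂}| ≤ (ε/2) · L` for
`φ` of oscillation `≤ L`. [cite: Simon1979Dobrushin, Lemma] -/
theorem abs_integral_tilted_sub_integral_tilted_le_linear' (μ : Measure S) [IsProbabilityMeasure μ]
    {h₁ h₂ : S → ℝ} (h1m : Measurable h₁) (h2m : Measurable h₂)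
    (h1b : ∃ B, ∀ s, |h₁ s| ≤ B) (h2b : ∃ B, ∀ s, |h₂ s| ≤ B)
    {ε : ℝ} (hε : ∀ s, |h₁ s - h₂ s| ≤ ε)
    {φ : S → ℝ} (hφm : Measurable φ) (hφb : ∃ M, ∀ s, |φ s| ≤ M)
    {L : ℝ} (hφL : ∀ a b, |φ a - φ b| ≤ L) :
    |∫ s, φ s ∂(μ.tilted h₁) - ∫ s, φ s ∂(μ.tilted h₂)| ≤ ε / 2 * L :=
  abs_integral_tilted_sub_integral_tilted_le_linear μ h1m h2m h1b h2b (κ := 0)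
    (fun s => by simpa using hε s) hφm hφb hφL

end Literature.Probability.LatticeModels.DobrushinMetric
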